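import Summits.BirchSwinnertonDyer.BirchSwinnertonDyer.Theorems.ByReductionTypeAtTwoSupersingularFlatBlindLocalKummerCongruence
import Literature.NumberTheory.EllipticCurves.LocalPointsFiniteIndexLatticeHolds
import Literature.NumberTheory.EllipticCurves.LocalPointsFiniteIndexLatticeProofs
import Literature.NumberTheory.EllipticCurves.Sprung2012.HondaLevelTwoRelationsProofs
import Summits.BirchSwinnertonDyer.BirchSwinnertonDyer.Theorems.ThetaPartnerAtTwoSignedKatoUpToAtTwoLocalTwoSignedIntersection
import HarnessLib

/-!
# Route `ByReductionTypeAtTwo` (rung K4), crux `SupersingularRankZeroAtTwo` (item stmt-BirchSwinnertonDyer-19097), line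
# `odd_blind_package` (registered v2.6.1, tree v2.8) slot 5, conjunct CDF_glob `OddBlindPackage.FlatBlindControlOfLocalAtTwo`:
# **HT-1 — THE LOCAL COUNT**: at the place `v ∋ 2`, Sprung's ♭ condition `L♭_J` on `H¹(ℚ_v, E[2^J](ψ₂))` meets the Kummer line
# `K_J` of the twist in a FINITE group of order `≤ 4`, uniformly in `J`, GIVEN the pointwise local transversality `hloc` of the line
# (cell `bsd-2adic`, seat `ss-1` GEN 20, LEAD-held piece of `HOME/ss/gen19/HAND-TARGETS-CDFglob.md` §1 step 1; part 2 of 2, part 1 =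
# `…FlatBlindLocalKummerCongruence.lean`).

HONEST FRAMING: THEOREMS ONLY (no definition, no named fact, no instance, no `sorry`); a helper `--supports 19097`; it proves neither
CDF_glob nor the crux; `hloc` is a HYPOTHESIS here (a theorem at `a₂ = 0`, p801290, and for Honda systems at `a₂ = ±2`, p811371); BSD is
proved for no curve by any of this.

## What is proved
* §4 `finite_and_natCard_flat_inf_kummerLine_le_pow` (any `K` of characteristic `0`, `p = 2`, `u = −1`, completion `E` with no `2`-torsion
  in `E(K_∞·K_v)`, any set of functionals `𝒦`, `E(K_1·K_v) ⊇ U ≃+ ℤ₂^d` of finite index): `L♭_J ⊓ K_J` is finite of order `≤ 2^d`,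
  where `L♭_J = twistedSharpFlatLocalKummer 2 κ J (−1) _ E (E(K_∞·K_v)) 𝒦` and `K_J = twistedTorsionLocalKummer 2 κ J (−1) _ E
  (E(K_1·K_v) ⊓ ker (g+1))`.  Proof: a class of the intersection is a Kummer class `∂Q'` with `x = 2^{N+1}Q'` a `ψ₂`-vector of layer `1`
  annihilated to order `2^{N+1}` by `𝒦` (the ♭ representative differs by a tower point and a `2^J`-torsion point), so `hloc` forces
  `x = 2^N w`, `w ∈ E(K_1·K_v)`; the class is determined by `w mod 2E(K_1·K_v)` (part 1, `oneCocycleClass_eq_of_kummer_congr`), and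
  `[E(K_1·K_v) : 2E(K_1·K_v)] = 2^d` (part 1, `index_range_zsmul_eq_pow_of_lattice`).
* §5 ★ `finite_and_natCard_flat_inf_kummerLine_le` (HT-1 over `ℚ`, `v ∋ 2`, `GoodSS W 2`): order `≤ 4`, by Silverman VII.6.3 at layer `1`
  (tree `silvermanVII63_localLayerPoints_finiteIndex_zpLattice_holds`, rank `2 = [ℚ_{1,v} : ℚ₂]`) and no `2`-torsion in the tower
  (`SignedKatoOffTwo.SignedIntersection.noTwoTorsion_localTowerPointsOfEmb_adicCompletion`).

References: [Sprung2012] F. Sprung, J. Number Theory 132 (2012), Def. 7.9 / 7.11 (p. 1503), Lemma 2.3; [GreenbergLNM1716] R. Greenberg,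
LNM 1716 (1999), §3, §4 pp. 122–124; [SilvermanAEC2009] J. Silverman, AEC, VII Prop. 6.3, III Cor. 6.4 (b).
-/

set_option autoImplicit false
set_option linter.dupNamespace false

noncomputable section

open scoped Classical NumberField

universe u v

namespace Summit.BirchSwinnertonDyer.BirchSwinnertonDyer.Theorems

namespace OddBlindLocal

open NumberField IsDedekindDomain Field WeierstrassCurve Literature.NumberTheory.EllipticCurves
  Literature.NumberTheory.GaloisRepresentations Literature.NumberTheory.GaloisCohomology ZpExtension
  Literature.NumberTheory.EllipticCurves.Kobayashi2003 Literature.NumberTheory.EllipticCurves.Sprung2017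
  Literature.NumberTheory.EllipticCurves.Sprung2012 Literature.NumberTheory.EllipticCurves.Rank1Residual
  CategoryTheory ContinuousCohomology TopRep ContRepresentation

/-! ## §4 HT-1: the ♭ condition meets the Kummer line of the twist in at most `[E(K_1·K_v) : 2E(K_1·K_v)]` classes -/

section Count

variable {K : Type u} [Field K] [CharZero K] (W : WeierstrassCurve K) [W.IsElliptic]
  (κ : ZpExtension K 2) (J : ℕ) (hu : ((2 : ℕ) : ℤ) ∣ (-1 : ℤ) - 1)
  (E : Type u) [Field E] [Algebra K E]

/-- ★ **HT-1, generic form (`p = 2`, `u = −1`, any base).** At a completion `E` of `K` where the tower `E(K_∞·K_v)` has no `2`-torsion,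
let `𝒦` be any set of functionals on `E(K_∞·K_v)` (meant: `Ker Col♭`), `g ∈ Γ_E` (meant: a lift of the topological generator) and suppose the
POINTWISE LOCAL TRANSVERSALITY `hloc`: every `ψ₂`-vector `y` of layer `1` (`g•y = −y`) outside `2^k·E(K_1·K_v)` has a `z ∈ 𝒦` with
`2^{k+1} ∤ z(y)`.  If `E(K_1·K_v)` contains a finite-index subgroup `U ≃+ ℤ₂^d`, then for every `J` the intersection of Sprung's ♭ condition
`L♭_J = twistedSharpFlatLocalKummer 2 κ J (−1) _ E (E(K_∞·K_v)) 𝒦` with the Kummer line of the twist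
`K_J = twistedTorsionLocalKummer 2 κ J (−1) _ E (E(K_1·K_v) ⊓ ker (g+1))` inside `H¹(Γ_E, E[2^J](ψ₂))` is FINITE of order `≤ 2^d`.
Proof: a class of `K_J` is `∂Q'` on `Gal(K̄_E/(K_∞)_w)` with `2^{k'}Q'` a `ψ₂`-vector of layer `1`; a class of `L♭_J` is `∂Q` with `2^kQ` in the
tower annihilated to order `2^k` by `𝒦`; equality of the classes makes `Q − Q'` a tower point plus the image of a `2^J`-torsion point, so
`x = 2^{N+1}Q'` (`N = k + k' + J`) is a `ψ₂`-vector annihilated to order `2^{N+1}`; `hloc` forces `x = 2^N w` with `w ∈ E(K_1·K_v)`, and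
`w mod 2E(K_1·K_v)` determines the class (§2); `[E(K_1·K_v) : 2E(K_1·K_v)] = 2^d` (§3).
[cite: Sprung2012, Def. 7.9 and Def. 7.11 (p. 1503)] [cite: GreenbergLNM1716, §3, §4 pp. 122–124] [cite: SilvermanAEC2009, VII Prop. 6.3] -/
theorem finite_and_natCard_flat_inf_kummerLine_le_pow
    (hnt : ∀ P ∈ localTowerPointsOfEmb κ (closureEmb (K := K) E) W, 2 • P = 0 → P = 0)
    (g : absoluteGaloisGroup E) (𝒦 : Set (↥(localTowerPointsOfEmb κ (closureEmb (K := K) E) W) →+ ℤ_[2]))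
    (hloc : ∀ (y : localPoints W E) (hy : y ∈ localLayerPointsOfEmb κ (closureEmb (K := K) E) W 1), g • y = -y →
      ∀ k : ℕ, (∀ w ∈ localLayerPointsOfEmb κ (closureEmb (K := K) E) W 1, 2 ^ k • w ≠ y) →
        ∃ z ∈ 𝒦, ¬ (2 : ℤ_[2]) ^ (k + 1) ∣
          z ⟨y, localLayerPointsOfEmb_le_localTowerPointsOfEmb κ (closureEmb (K := K) E) W 1 hy⟩)
    {d : ℕ} (U : AddSubgroup ↥(localLayerPointsOfEmb κ (closureEmb (K := K) E) W 1)) [U.FiniteIndex]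
    (eU : U ≃+ (Fin d → ℤ_[2])) :
    Finite ↥(W.twistedSharpFlatLocalKummer 2 κ J (-1) hu E (localTowerPointsOfEmb κ (closureEmb (K := K) E) W) 𝒦 ⊓
      W.twistedTorsionLocalKummer 2 κ J (-1) hu E (localLayerPointsOfEmb κ (closureEmb (K := K) E) W 1 ⊓
        (DistribSMul.toAddMonoidHom (localPoints W E) g + AddMonoidHom.id _).ker)) ∧
    Nat.card ↥(W.twistedSharpFlatLocalKummer 2 κ J (-1) hu E (localTowerPointsOfEmb κ (closureEmb (K := K) E) W) 𝒦 ⊓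
      W.twistedTorsionLocalKummer 2 κ J (-1) hu E (localLayerPointsOfEmb κ (closureEmb (K := K) E) W 1 ⊓
        (DistribSMul.toAddMonoidHom (localPoints W E) g + AddMonoidHom.id _).ker)) ≤ 2 ^ d := by
  have hle1 := localLayerPointsOfEmb_le_localTowerPointsOfEmb κ (closureEmb (K := K) E) W 1
  -- §3: `[E(K_1·K_v) : 2 E(K_1·K_v)] = 2^d`
  have hindex : ((zsmulAddGroupHom ((2 : ℕ) : ℤ) : ↥(localLayerPointsOfEmb κ (closureEmb (K := K) E) W 1) →+
      ↥(localLayerPointsOfEmb κ (closureEmb (K := K) E) W 1)).range).index = 2 ^ d :=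
    index_range_zsmul_eq_pow_of_lattice 2 U eU (fun a ha ↦ Subtype.ext
      (hnt _ (hle1 a.2) (by rw [← AddSubgroupClass.coe_nsmul, ha, ZeroMemClass.coe_zero])))
  haveI : ((zsmulAddGroupHom ((2 : ℕ) : ℤ) : ↥(localLayerPointsOfEmb κ (closureEmb (K := K) E) W 1) →+
      ↥(localLayerPointsOfEmb κ (closureEmb (K := K) E) W 1)).range).FiniteIndex :=
    ⟨by rw [hindex]; exact pow_ne_zero _ two_ne_zero⟩
  haveI : Finite (↥(localLayerPointsOfEmb κ (closureEmb (K := K) E) W 1) ⧸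
      (zsmulAddGroupHom ((2 : ℕ) : ℤ) : ↥(localLayerPointsOfEmb κ (closureEmb (K := K) E) W 1) →+
        ↥(localLayerPointsOfEmb κ (closureEmb (K := K) E) W 1)).range) :=
    AddSubgroup.finite_quotient_of_finiteIndex
  -- the datum `w mod 2` of a class of the intersection
  have hex : ∀ y : ↥(W.twistedSharpFlatLocalKummer 2 κ J (-1) hu E (localTowerPointsOfEmb κ (closureEmb (K := K) E) W) 𝒦 ⊓
      W.twistedTorsionLocalKummer 2 κ J (-1) hu E (localLayerPointsOfEmb κ (closureEmb (K := K) E) W 1 ⊓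
        (DistribSMul.toAddMonoidHom (localPoints W E) g + AddMonoidHom.id _).ker)),
      ∃ (w : ↥(localLayerPointsOfEmb κ (closureEmb (K := K) E) W 1))
        (ψ : contOneCocycles ((W.twistedTorsionGaloisModule 2 κ J (-1) hu).restrictField E).toTopRep)
        (Q : localPoints W E) (N : ℕ),
        oneCocycleClass _ ψ = (y : galoisCohomology ((W.twistedTorsionGaloisModule 2 κ J (-1) hu).restrictField E) 1) ∧
        (∀ τ : localSubgroup κ.kerSubgroup E,
          pointsMap W E ((ψ.1 (τ : absoluteGaloisGroup E) : W.geomTorsion ((2 ^ J : ℕ) : ℤ)) : W.geomPoints) =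
            (τ : absoluteGaloisGroup E) • Q - Q) ∧
        2 ^ N • (w : localPoints W E) = 2 ^ (N + 1) • Q := by
    intro y
    obtain ⟨ψ, Q, k, hQT, hyψ, hdiv, hτ⟩ := y.2.1
    obtain ⟨ψ', Q', k', hyψ', hA, hτ'⟩ := y.2.2
    -- `ψ − ψ'` is principal with vector `m`
    have h0 : oneCocycleClass _ (ψ - ψ') = 0 := by rw [oneCocycleClass_sub, hyψ, hyψ', sub_self]
    obtain ⟨m, hm⟩ := (oneCocycleClass_eq_zero_iff _ _).1 h0
    -- `Q − Q' − ι(m)` is a tower point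
    have hR : Q - Q' - pointsMap W E ((m : W.geomTorsion ((2 ^ J : ℕ) : ℤ)) : W.geomPoints) ∈
        localTowerPointsOfEmb κ (closureEmb (K := K) E) W := by
      rw [mem_localTowerPointsOfEmb_iff]
      intro τ hτmem
      have e3 : pointsMap W E (((ψ - ψ').1 τ : W.geomTorsion ((2 ^ J : ℕ) : ℤ)) : W.geomPoints) =
          τ • pointsMap W E ((m : W.geomTorsion ((2 ^ J : ℕ) : ℤ)) : W.geomPoints) -
            pointsMap W E ((m : W.geomTorsion ((2 ^ J : ℕ) : ℤ)) : W.geomPoints) := by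
        rw [hm τ, AddSubgroupClass.coe_sub, map_sub, pointsMap_twisted_rho_of_mem_localSubgroup W 2 κ J (-1) hu E hτmem m]
      rw [Submodule.coe_sub, ContinuousMap.sub_apply, AddSubgroupClass.coe_sub, map_sub, hτ ⟨τ, hτmem⟩,
        hτ' ⟨τ, hτmem⟩] at e3
      have e4 : τ • Q - τ • Q' = Q - Q' + (τ • pointsMap W E ((m : W.geomTorsion ((2 ^ J : ℕ) : ℤ)) : W.geomPoints) -
          pointsMap W E ((m : W.geomTorsion ((2 ^ J : ℕ) : ℤ)) : W.geomPoints)) := by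
        rw [← e3]; abel
      rw [smul_sub, smul_sub, e4]
      abel
    -- `x := 2^(N+1) • Q'` (`N = k + k' + J`) is a `ψ₂`-vector of layer `1`
    have hxA : 2 ^ (k + k' + J + 1) • Q' ∈ localLayerPointsOfEmb κ (closureEmb (K := K) E) W 1 ⊓
        (DistribSMul.toAddMonoidHom (localPoints W E) g + AddMonoidHom.id _).ker := by
      have h : 2 ^ (k + k' + J + 1) • Q' = 2 ^ (k + J + 1) • (2 ^ k' • Q') := by
        rw [← mul_smul, ← pow_add]; congr 1; ring
      rw [h]; exact AddSubgroup.nsmul_mem _ hA _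
    have hxM : 2 ^ (k + k' + J + 1) • Q' ∈ localLayerPointsOfEmb κ (closureEmb (K := K) E) W 1 := hxA.1
    have hgx : g • (2 ^ (k + k' + J + 1) • Q') = -(2 ^ (k + k' + J + 1) • Q' : localPoints W E) := by
      have h : (DistribSMul.toAddMonoidHom (localPoints W E) g + AddMonoidHom.id (localPoints W E) :
          localPoints W E →+ localPoints W E) (2 ^ (k + k' + J + 1) • Q') = 0 := hxA.2
      rw [AddMonoidHom.add_apply, DistribSMul.toAddMonoidHom_apply, AddMonoidHom.id_apply] at h
      exact eq_neg_of_add_eq_zero_left h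
    -- `z(x)` is divisible by `2^(N+1)` for `z ∈ 𝒦`
    have hDm0 : 2 ^ (k + k' + J + 1) • pointsMap W E ((m : W.geomTorsion ((2 ^ J : ℕ) : ℤ)) : W.geomPoints) = 0 := by
      rw [show k + k' + J + 1 = (k + k' + 1) + J by ring, pow_add, mul_smul, ← map_nsmul (pointsMap W E) (2 ^ J),
        ← AddSubgroupClass.coe_nsmul, W.pow_nsmul_geomTorsion_pow 2 J, ZeroMemClass.coe_zero, map_zero, smul_zero]
    have hdivx : ∀ z ∈ 𝒦, (2 : ℤ_[2]) ^ (k + k' + J + 1) ∣ z ⟨2 ^ (k + k' + J + 1) • Q', hle1 hxM⟩ := by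
      intro z hz
      have hsub : (⟨2 ^ (k + k' + J + 1) • Q', hle1 hxM⟩ : ↥(localTowerPointsOfEmb κ (closureEmb (K := K) E) W)) =
          2 ^ (k' + J + 1) • ⟨2 ^ k • Q, hQT⟩ - 2 ^ (k + k' + J + 1) • ⟨_, hR⟩ := by
        apply Subtype.ext
        rw [AddSubgroupClass.coe_sub, AddSubgroupClass.coe_nsmul, AddSubgroupClass.coe_nsmul, ← mul_smul, ← pow_add,
          show k' + J + 1 + k = k + k' + J + 1 by ring, smul_sub, smul_sub, hDm0, sub_zero, sub_sub_cancel]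
      rw [hsub, map_sub, map_nsmul, map_nsmul]
      refine dvd_sub ?_ ?_
      · obtain ⟨t, ht⟩ := hdiv z hz
        rw [ht, nsmul_eq_mul, Nat.cast_pow, Nat.cast_ofNat, ← mul_assoc, ← pow_add,
          show k' + J + 1 + k = k + k' + J + 1 by ring]
        exact dvd_mul_right _ _
      · rw [nsmul_eq_mul, Nat.cast_pow, Nat.cast_ofNat]
        exact dvd_mul_right _ _
    -- `hloc` (contrapositive): `x = 2^N • w` with `w ∈ E(K_1·K_v)`
    have hw : ∃ w ∈ localLayerPointsOfEmb κ (closureEmb (K := K) E) W 1,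
        2 ^ (k + k' + J) • w = 2 ^ (k + k' + J + 1) • Q' := by
      by_contra hcon
      simp only [not_exists, not_and] at hcon
      obtain ⟨z, hz, hndvd⟩ := hloc _ hxM hgx (k + k' + J) hcon
      exact hndvd (hdivx z hz)
    obtain ⟨w, hwM, hw⟩ := hw
    exact ⟨⟨w, hwM⟩, ψ', Q', k + k' + J, hyψ', hτ', hw⟩
  choose wf ψf Qf Nf hclass hτf hwf using hex
  -- the class is determined by `w mod 2 E(K_1·K_v)` (§2)
  let Ψ : ↥(W.twistedSharpFlatLocalKummer 2 κ J (-1) hu E (localTowerPointsOfEmb κ (closureEmb (K := K) E) W) 𝒦 ⊓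
      W.twistedTorsionLocalKummer 2 κ J (-1) hu E (localLayerPointsOfEmb κ (closureEmb (K := K) E) W 1 ⊓
        (DistribSMul.toAddMonoidHom (localPoints W E) g + AddMonoidHom.id _).ker)) →
      ↥(localLayerPointsOfEmb κ (closureEmb (K := K) E) W 1) ⧸
        (zsmulAddGroupHom ((2 : ℕ) : ℤ) : ↥(localLayerPointsOfEmb κ (closureEmb (K := K) E) W 1) →+
          ↥(localLayerPointsOfEmb κ (closureEmb (K := K) E) W 1)).range :=
    fun y ↦ QuotientAddGroup.mk (wf y)
  have hΨ : ∀ y, Ψ y = QuotientAddGroup.mk (wf y) := fun _ ↦ rfl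
  have hinj : Function.Injective Ψ := by
    intro y₁ y₂ h
    rw [hΨ, hΨ, QuotientAddGroup.eq] at h
    obtain ⟨e', he'⟩ := h
    have he'2 : ((2 : ℕ) : ℤ) • e' = -wf y₁ + wf y₂ := he'
    have he'c : ((2 : ℕ) : ℤ) • (e' : localPoints W E) = -(wf y₁ : localPoints W E) + wf y₂ := by
      have h := congrArg Subtype.val he'2
      simp only [AddSubgroupClass.coe_zsmul, AddSubgroup.coe_add, AddSubgroup.coe_neg] at h
      exact h
    apply Subtype.ext
    rw [← hclass y₁, ← hclass y₂]
    refine oneCocycleClass_eq_of_kummer_congr W 2 κ J (-1) hu E hnt (ψf y₁) (ψf y₂) (hτf y₁) (hτf y₂)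
      (e := -(e' : localPoints W E)) (D := Qf y₁ - Qf y₂ + e') (neg_mem (hle1 e'.2)) (N := Nf y₁ + Nf y₂ + 1) ?_ (by abel)
    have e1 : 2 ^ (Nf y₁ + Nf y₂ + 1) • Qf y₁ = 2 ^ Nf y₂ • (2 ^ Nf y₁ • (wf y₁ : localPoints W E)) := by
      rw [show Nf y₁ + Nf y₂ + 1 = Nf y₂ + (Nf y₁ + 1) by ring, pow_add, mul_smul, hwf y₁]
    have e2 : 2 ^ (Nf y₁ + Nf y₂ + 1) • Qf y₂ = 2 ^ Nf y₁ • (2 ^ Nf y₂ • (wf y₂ : localPoints W E)) := by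
      rw [show Nf y₁ + Nf y₂ + 1 = Nf y₁ + (Nf y₂ + 1) by ring, pow_add, mul_smul, hwf y₂]
    have he'n : 2 • (e' : localPoints W E) = -(wf y₁ : localPoints W E) + wf y₂ := by
      rw [← natCast_zsmul]; exact he'c
    have e3 : 2 ^ (Nf y₁ + Nf y₂ + 1) • (e' : localPoints W E) =
        2 ^ (Nf y₁ + Nf y₂) • (-(wf y₁ : localPoints W E) + wf y₂) := by
      rw [← he'n, pow_succ, mul_smul]
    rw [smul_add, smul_sub, e1, e2, e3, ← mul_smul, ← mul_smul, ← pow_add, ← pow_add, add_comm (Nf y₂) (Nf y₁),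
      smul_add, smul_neg]
    abel
  exact ⟨Finite.of_injective Ψ hinj, (Nat.card_le_card_of_injective Ψ hinj).trans (le_of_eq hindex)⟩

end Count

/-! ## §5 HT-1 over `ℚ` at `v ∋ 2`: order `≤ 4` -/

section Rat

/-- ★★ **HT-1 (THE LOCAL COUNT of CDF_glob) over `ℚ`.** For `W/ℚ` elliptic, globally minimal, good supersingular at `2`, any `ℤ₂`-extension `κ`
with a local lift `g ∈ Γ_{ℚ_v}` of a topological generator (`v ∋ 2`), any set `𝒦` of functionals on `E(ℚ_{∞,v})` (meant: `Ker Col♭` of the line's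
system) satisfying the line's POINTWISE LOCAL TRANSVERSALITY `hloc` (slot 5's CDF±, a THEOREM at `a₂ = 0` by p801290 and for Honda systems by
p811371), and every level `J`: Sprung's ♭ condition `L♭_J` meets the Kummer line `K_J` of the twist in a FINITE subgroup of `H¹(ℚ_v, E[2^J](ψ₂))`
of order `≤ 4 = [E(ℚ_{1,v}) : 2E(ℚ_{1,v})]` (Silverman VII.6.3 at layer `1`, tree `silvermanVII63_localLayerPoints_finiteIndex_zpLattice_holds`,
rank `[ℚ_{1,v} : ℚ₂] = 2` by `index_localLayerSubgroupOfEmb_eq_pow_of_isTopGenerator`; no `2`-torsion in the tower by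
`SignedKatoOffTwo.SignedIntersection.noTwoTorsion_localTowerPointsOfEmb_adicCompletion`).  This is the LEAD-held input `hloc` of
`OddBlindTwist.natCard_selmerGroup_update_le_uniform` (p807657) on the road to `OddBlindPackage.FlatBlindControlOfLocalAtTwo`; it proves
neither CDF_glob nor the crux; BSD is proved for no curve. [cite: Sprung2012, Def. 7.9 and Def. 7.11 (p. 1503), Lemma 2.3]
[cite: GreenbergLNM1716, §3, §4 pp. 122–124] [cite: SilvermanAEC2009, VII Prop. 6.3] -/
theorem finite_and_natCard_flat_inf_kummerLine_le (W : WeierstrassCurve ℚ) [W.IsElliptic] [W.IsGloballyMinimal]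
    (hss : GoodSS W 2) (κ : ZpExtension ℚ 2) (J : ℕ) (hu : ((2 : ℕ) : ℤ) ∣ (-1 : ℤ) - 1)
    (v : HeightOneSpectrum (𝓞 ℚ)) (hv : (2 : 𝓞 ℚ) ∈ v.asIdeal)
    {g : absoluteGaloisGroup (v.adicCompletion ℚ)}
    (hg : κ.IsTopGenerator (resGalOfEmb (closureEmb (K := ℚ) (v.adicCompletion ℚ)) g))
    (𝒦 : Set (↥(localTowerPointsOfEmb κ (closureEmb (K := ℚ) (v.adicCompletion ℚ)) W) →+ ℤ_[2]))
    (hloc : ∀ (y : localPoints W (v.adicCompletion ℚ))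
      (hy : y ∈ localLayerPointsOfEmb κ (closureEmb (K := ℚ) (v.adicCompletion ℚ)) W 1), g • y = -y →
      ∀ k : ℕ, (∀ w ∈ localLayerPointsOfEmb κ (closureEmb (K := ℚ) (v.adicCompletion ℚ)) W 1, 2 ^ k • w ≠ y) →
        ∃ z ∈ 𝒦, ¬ (2 : ℤ_[2]) ^ (k + 1) ∣
          z ⟨y, localLayerPointsOfEmb_le_localTowerPointsOfEmb κ (closureEmb (K := ℚ) (v.adicCompletion ℚ)) W 1 hy⟩) :
    Finite ↥(W.twistedSharpFlatLocalKummer 2 κ J (-1) hu (v.adicCompletion ℚ)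
        (localTowerPointsOfEmb κ (closureEmb (K := ℚ) (v.adicCompletion ℚ)) W) 𝒦 ⊓
      W.twistedTorsionLocalKummer 2 κ J (-1) hu (v.adicCompletion ℚ)
        (localLayerPointsOfEmb κ (closureEmb (K := ℚ) (v.adicCompletion ℚ)) W 1 ⊓
          (DistribSMul.toAddMonoidHom (localPoints W (v.adicCompletion ℚ)) g + AddMonoidHom.id _).ker)) ∧
    Nat.card ↥(W.twistedSharpFlatLocalKummer 2 κ J (-1) hu (v.adicCompletion ℚ)
        (localTowerPointsOfEmb κ (closureEmb (K := ℚ) (v.adicCompletion ℚ)) W) 𝒦 ⊓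
      W.twistedTorsionLocalKummer 2 κ J (-1) hu (v.adicCompletion ℚ)
        (localLayerPointsOfEmb κ (closureEmb (K := ℚ) (v.adicCompletion ℚ)) W 1 ⊓
          (DistribSMul.toAddMonoidHom (localPoints W (v.adicCompletion ℚ)) g + AddMonoidHom.id _).ker)) ≤ 4 := by
  have hv' : ((2 : ℕ) : 𝓞 ℚ) ∈ v.asIdeal := by exact_mod_cast hv
  obtain ⟨H, hHle, hfin, hφ⟩ := silvermanVII63_localLayerPoints_finiteIndex_zpLattice.rat
    silvermanVII63_localLayerPoints_finiteIndex_zpLattice_holds κ hv' (closureEmb (K := ℚ) (v.adicCompletion ℚ)) W 1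
  rw [index_localLayerSubgroupOfEmb_eq_pow_of_isTopGenerator κ (closureEmb (K := ℚ) (v.adicCompletion ℚ)) hg 1, pow_one] at hφ
  obtain ⟨φ⟩ := hφ
  haveI := hfin
  obtain ⟨h1, h2⟩ := finite_and_natCard_flat_inf_kummerLine_le_pow W κ J hu (v.adicCompletion ℚ)
    (SignedKatoOffTwo.SignedIntersection.noTwoTorsion_localTowerPointsOfEmb_adicCompletion W hss κ v hv _) g 𝒦 hloc
    (H.addSubgroupOf _) ((AddSubgroup.addSubgroupOfEquivOfLe hHle).trans φ)
  exact ⟨h1, h2.trans (by norm_num)⟩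

end Rat

end OddBlindLocal

end Summit.BirchSwinnertonDyer.BirchSwinnertonDyer.Theorems

end
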